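import Summits.KontsevichZagierPeriods.KontsevichZagierPeriods.Theorems.RootDecompWalshStrataConeBaker
import Literature.NumberTheory.Transcendental.KZSemialgebraicComplex

/-!
# Conic descent 1/7: the Baker sector modulo relations; bounded data; rule (3) over any base

Gen 4 of the decomposition node `WalshStrata` (route `RootDecompWalshStrata`, support item
`QuadricBakerDescent`, stmt-KontsevichZagierPeriods-27597): the conic stratum `d ≤ 2` IN FULL — every
weighted conic Walsh cell `[{x ∈ (0,1)^d : P(x) > 0}, q]`, `deg P ≤ 2`, `d ≤ 2`, `q ∈ ℚ`, is equivalent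
under KZ's rules (1)–(3) over `ℚ` to an element of the Baker sector `⟨[N] : dim N ≤ 1, N rational⟩`
(`quadricBakerDescent_two`, part 7/7).  This part: `bakerSector`, the predicate `InBaker x`
(`x ≡ Baker-sector element mod KZ.relations`) and its calculus; representations from bounded
semialgebraic data (`bddRep`), restriction and two-piece splitting (rule (1a)); open bands
`oband X l u` over an ARBITRARY `ℚ`-semialgebraic base and the rule-(3) band identity
`[oband X l u, q] − [X, q·(u − l)] ∈ KZ.relations` (`of_bandRep_sub_of_lenRep_mem_relations`) — no
cylindrical decomposition of the base is needed.  Imports: the landed cone specimen part 3 (for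
`unitIoo`, Walsh cells) and `KZSemialgebraicComplex` (measurability of semialgebraic functions);
0 sorry. [KontsevichZagier2001 §1.1–1.2; BCR1998 §2.2]
-/

noncomputable section

open Literature.NumberTheory.Transcendental
open MeasureTheory Set
open MvPolynomial (aeval X C)
open Literature.ModelTheory.ExponentialFields (IsSemialgebraic isSemialgebraic_univ
  isSemialgebraic_setOf_eval_pos isSemialgebraic_setOf_eval_lt isSemialgebraic_setOf_eval_le
  isSemialgebraic_setOf_eval_nonneg isSemialgebraic_setOf_eval_eq_zero continuous_aeval_real
  tarski_seidenberg_real_holds)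
open Summit.KontsevichZagierPeriods.RootDecompWalshStrata.WalshSpanProof (isSemialgebraic_cubeSet
  isBounded_cubeSet)
open Summit.KontsevichZagierPeriods.RootDecompWalshStrata.ConeSpecimen (unitIoo isSemialgebraic_unitIoo
  unitIoo_subset_Icc mem_unitIoo)

namespace Summit.KontsevichZagierPeriods.RootDecompWalshStrata.ConicDescent

/-- The BAKER SECTOR: the subgroup of formal combinations generated by the RATIONAL representations
of dimension `≤ 1` (values in `ℚ + ℚπ + Σ ℚ̄ log ℚ̄`). [KontsevichZagier2001 §1.1; Baker1975 Thm 2.1] -/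
def bakerSector : AddSubgroup KZ.FormalRep :=
  AddSubgroup.closure
    {y : KZ.FormalRep | ∃ (m : ℕ) (N : KZ.IntegralRep m), m ≤ 1 ∧ N.IsRational ∧ y = KZ.of N}

/-! #### 1. The Baker sector modulo relations -/

/-- The set of formal combinations congruent modulo `KZ.relations` to an element of the Baker sector
(the carrier of `bakerSector ⊔ KZ.relations`); used applicatively, `InBaker x`. [this node] -/
def InBaker : Set KZ.FormalRep := {x | ∃ y ∈ bakerSector, x - y ∈ KZ.relations}

namespace InBaker

/-- A relation lies in the Baker sector modulo relations (witness `0`). [this node] -/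
theorem of_mem_relations {x : KZ.FormalRep} (hx : x ∈ KZ.relations) : InBaker x :=
  ⟨0, bakerSector.zero_mem, by simpa using hx⟩

/-- `0` lies in the Baker sector modulo relations. [this node] -/
theorem zero : InBaker 0 := of_mem_relations KZ.relations.zero_mem

/-- `InBaker` is closed under addition. [this node] -/
theorem add {x y : KZ.FormalRep} (hx : InBaker x) (hy : InBaker y) : InBaker (x + y) := by
  obtain ⟨a, ha, hxa⟩ := hx
  obtain ⟨b, hb, hyb⟩ := hy
  refine ⟨a + b, bakerSector.add_mem ha hb, ?_⟩
  have : x + y - (a + b) = (x - a) + (y - b) := by abel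
  rw [this]
  exact KZ.relations.add_mem hxa hyb

/-- `InBaker` is closed under negation. [this node] -/
theorem neg {x : KZ.FormalRep} (hx : InBaker x) : InBaker (-x) := by
  obtain ⟨a, ha, hxa⟩ := hx
  refine ⟨-a, bakerSector.neg_mem ha, ?_⟩
  have : -x - -a = -(x - a) := by abel
  rw [this]
  exact KZ.relations.neg_mem hxa

/-- `InBaker` is closed under subtraction. [this node] -/
theorem sub {x y : KZ.FormalRep} (hx : InBaker x) (hy : InBaker y) : InBaker (x - y) := by
  simpa [sub_eq_add_neg] using hx.add hy.neg

/-- Transport along a relation: if `x' ≡ x` and `x` lands in the Baker sector, so does `x'`. -/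
theorem congr {x x' : KZ.FormalRep} (hx : InBaker x) (h : x' - x ∈ KZ.relations) : InBaker x' := by
  obtain ⟨a, ha, hxa⟩ := hx
  refine ⟨a, ha, ?_⟩
  have : x' - a = (x' - x) + (x - a) := by abel
  rw [this]
  exact KZ.relations.add_mem h hxa

/-- A rational representation of dimension `≤ 1` is a generator of the Baker sector. [KontsevichZagier2001 §1.1] -/
theorem of_isRational {m : ℕ} (N : KZ.IntegralRep m) (hm : m ≤ 1) (hN : N.IsRational) :
    InBaker (KZ.of N) :=
  ⟨KZ.of N, AddSubgroup.subset_closure ⟨m, N, hm, hN, rfl⟩, by simp [KZ.relations.zero_mem]⟩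

end InBaker

/-! #### 2. Representations from bounded semialgebraic data; restriction and splitting -/

/-- A bounded `ℚ`-semialgebraic function on a bounded `ℚ`-semialgebraic set is absolutely
integrable there. [folklore] -/
theorem integrableOn_of_bdd {N : ℕ} {s : Set (Fin N → ℝ)} (hs : IsSemialgebraic ℚ s)
    (hb : Bornology.IsBounded s) {f : (Fin N → ℝ) → ℝ} (hf : IsSemialgebraicFunOn ℚ s f) (M : ℝ)
    (hM : ∀ x ∈ s, |f x| ≤ M) : IntegrableOn f s volume := by
  have hms : MeasurableSet s := hs.measurableSet_holds
  refine Integrable.mono' (integrableOn_const (hs := hb.measure_lt_top.ne) (C := M))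
    (KZ.aestronglyMeasurable_of_isSemialgebraicFunOn hf hms)
    ((ae_restrict_mem hms).mono fun x hx => ?_)
  rw [Real.norm_eq_abs]
  exact hM x hx

/-- The representation `[s, f]` attached to bounded semialgebraic data. [KontsevichZagier2001 §1.1] -/
def bddRep {N : ℕ} (s : Set (Fin N → ℝ)) (hs : IsSemialgebraic ℚ s) (hb : Bornology.IsBounded s)
    (f : (Fin N → ℝ) → ℝ) (hf : IsSemialgebraicFunOn ℚ s f) (M : ℝ) (hM : ∀ x ∈ s, |f x| ≤ M) :
    KZ.IntegralRep N where
  domain := s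
  integrand := f
  isSemialgebraic_domain := hs
  isSemialgebraicFunOn_integrand := hf
  integrableOn := integrableOn_of_bdd hs hb hf M hM

/-- The domain of `bddRep` is the given set. [this node] -/
@[simp] theorem bddRep_domain {N : ℕ} (s : Set (Fin N → ℝ)) (hs : IsSemialgebraic ℚ s)
    (hb : Bornology.IsBounded s) (f : (Fin N → ℝ) → ℝ) (hf : IsSemialgebraicFunOn ℚ s f) (M : ℝ)
    (hM : ∀ x ∈ s, |f x| ≤ M) : (bddRep s hs hb f hf M hM).domain = s := rfl

/-- The integrand of `bddRep` is the given function. [this node] -/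
@[simp] theorem bddRep_integrand {N : ℕ} (s : Set (Fin N → ℝ)) (hs : IsSemialgebraic ℚ s)
    (hb : Bornology.IsBounded s) (f : (Fin N → ℝ) → ℝ) (hf : IsSemialgebraicFunOn ℚ s f) (M : ℝ)
    (hM : ∀ x ∈ s, |f x| ≤ M) : (bddRep s hs hb f hf M hM).integrand = f := rfl

/-- Rule (1a) for a two-piece partition: `[σ] − [σ ∩ A] − [σ ∩ B]` with `σ = A ∪ B`, `A ∩ B` null.
[KontsevichZagier2001 §1.2 rule (1)] -/
theorem of_sub_restrict_sub_restrict_mem_relations {N : ℕ} (r : KZ.IntegralRep N)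
    {A B : Set (Fin N → ℝ)} (hA : IsSemialgebraic ℚ A) (hB : IsSemialgebraic ℚ B)
    (hAr : A ⊆ r.domain) (hBr : B ⊆ r.domain) (heq : r.domain = A ∪ B) (hvol : volume (A ∩ B) = 0) :
    KZ.of r - KZ.of (r.restrict A hA hAr) - KZ.of (r.restrict B hB hBr) ∈ KZ.relations :=
  KZ.domainAddRel_subset_relations ⟨N, r, r.restrict A hA hAr, r.restrict B hB hBr, heq, hvol,
    fun _ _ => rfl, fun _ _ => rfl, rfl⟩

/-- `InBaker` is checked piecewise on a two-piece partition of the domain. -/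
theorem InBaker.of_split {N : ℕ} (r : KZ.IntegralRep N) {A B : Set (Fin N → ℝ)}
    (hA : IsSemialgebraic ℚ A) (hB : IsSemialgebraic ℚ B) (hAr : A ⊆ r.domain) (hBr : B ⊆ r.domain)
    (heq : r.domain = A ∪ B) (hvol : volume (A ∩ B) = 0)
    (h₁ : InBaker (KZ.of (r.restrict A hA hAr))) (h₂ : InBaker (KZ.of (r.restrict B hB hBr))) :
    InBaker (KZ.of r) := by
  refine (h₁.add h₂).congr ?_
  have := of_sub_restrict_sub_restrict_mem_relations r hA hB hAr hBr heq hvol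
  rwa [sub_sub] at this

/-- `InBaker` survives discarding a part of the domain on which the integrand vanishes. -/
theorem InBaker.of_restrict_of_eqOn_zero {N : ℕ} (r : KZ.IntegralRep N) {A : Set (Fin N → ℝ)}
    (hA : IsSemialgebraic ℚ A) (hAr : A ⊆ r.domain) (h0 : ∀ x ∈ r.domain, x ∉ A → r.integrand x = 0)
    (h₁ : InBaker (KZ.of (r.restrict A hA hAr))) : InBaker (KZ.of r) := by
  have hB : IsSemialgebraic ℚ (r.domain \ A) := r.isSemialgebraic_domain.diff hA
  have hBr : r.domain \ A ⊆ r.domain := fun _ hx => hx.1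
  refine InBaker.of_split r hA hB hAr hBr (by rw [union_sdiff_cancel hAr]) (by simp) h₁ ?_
  exact InBaker.of_mem_relations (KZ.of_mem_relations_of_eqOn_zero _ fun x hx => h0 x hx.1 hx.2)

/-! #### 3. Open bands and rule (3) with a linear primitive -/

/-- The open band `{(x, t) | x ∈ X, l x < t < u x}` (last coordinate the fibre). -/
def oband {N : ℕ} (X : Set (Fin N → ℝ)) (l u : (Fin N → ℝ) → ℝ) : Set (Fin (N + 1) → ℝ) :=
  {z | Fin.init z ∈ X ∧ l (Fin.init z) < z (Fin.last N) ∧ z (Fin.last N) < u (Fin.init z)}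

/-- Membership in an open band, unfolded. [this node] -/
theorem mem_oband {N : ℕ} {X : Set (Fin N → ℝ)} {l u : (Fin N → ℝ) → ℝ} {z : Fin (N + 1) → ℝ} :
    z ∈ oband X l u ↔ Fin.init z ∈ X ∧ l (Fin.init z) < z (Fin.last N) ∧ z (Fin.last N) < u (Fin.init z) :=
  Iff.rfl

/-- An open band with semialgebraic edges over a semialgebraic base is semialgebraic.
[BCR1998 §2.2] -/
theorem isSemialgebraic_oband {N : ℕ} {X : Set (Fin N → ℝ)} {l u : (Fin N → ℝ) → ℝ}
    (hl : IsSemialgebraicFunOn ℚ X l) (hu : IsSemialgebraicFunOn ℚ X u) :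
    IsSemialgebraic ℚ (oband X l u) := by
  have hGa : IsSemialgebraic ℚ {z : Fin (N + 1) → ℝ | Fin.init z ∈ X ∧ z (Fin.last N) = l (Fin.init z)} :=
    isSemialgebraicFunOn_iff.mp hl
  have hGb : IsSemialgebraic ℚ {z : Fin (N + 1) → ℝ | Fin.init z ∈ X ∧ z (Fin.last N) = u (Fin.init z)} :=
    isSemialgebraicFunOn_iff.mp hu
  have h := (KZlog.isSemialgebraic_band hl hu).diff (hGa.union hGb)
  convert h using 1
  ext z
  simp only [oband, mem_setOf_eq, mem_sdiff, mem_union, KZlog.mem_band, not_or, not_and]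
  constructor
  · rintro ⟨hzB, h1, h2⟩
    exact ⟨⟨hzB, h1.le, h2.le⟩, fun _ => h1.ne', fun _ => h2.ne⟩
  · rintro ⟨⟨hzB, h1, h2⟩, h3, h4⟩
    exact ⟨hzB, lt_of_le_of_ne h1 (fun h => h3 hzB h.symm), lt_of_le_of_ne h2 (h4 hzB)⟩

/-- A band over a base inside the unit cube with edges in `[0, 1]` lies in the unit cube. -/
theorem oband_subset_Icc {N : ℕ} {X : Set (Fin N → ℝ)} {l u : (Fin N → ℝ) → ℝ}
    (hX : X ⊆ Icc 0 1) (hl0 : ∀ x ∈ X, 0 ≤ l x) (hu1 : ∀ x ∈ X, u x ≤ 1) :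
    oband X l u ⊆ Icc 0 1 := by
  intro z hz
  obtain ⟨hzX, h1, h2⟩ := hz
  have hI := hX hzX
  refine ⟨fun j => ?_, fun j => ?_⟩
  · refine Fin.lastCases ?_ (fun i => ?_) j
    · exact (hl0 _ hzX).trans h1.le
    · simpa [Fin.init] using hI.1 i
  · refine Fin.lastCases ?_ (fun i => ?_) j
    · exact h2.le.trans (hu1 _ hzX)
    · simpa [Fin.init] using hI.2 i

/-- The weighted open band `[{x ∈ X, l x < t < u x}, q]`. [KontsevichZagier2001 §1.1] -/
def bandRep {N : ℕ} (X : Set (Fin N → ℝ)) (_hXs : IsSemialgebraic ℚ X) (hX : X ⊆ Icc 0 1)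
    (l u : (Fin N → ℝ) → ℝ) (hl : IsSemialgebraicFunOn ℚ X l) (hu : IsSemialgebraicFunOn ℚ X u)
    (hl0 : ∀ x ∈ X, 0 ≤ l x) (hu1 : ∀ x ∈ X, u x ≤ 1) (q : ℚ) : KZ.IntegralRep (N + 1) where
  domain := oband X l u
  integrand _ := (q : ℝ)
  isSemialgebraic_domain := isSemialgebraic_oband hl hu
  isSemialgebraicFunOn_integrand := isSemialgebraicFunOn_ratCast (isSemialgebraic_oband hl hu) q
  integrableOn := integrableOn_const (hs :=
    (((isCompact_Icc (a := (0 : Fin (N + 1) → ℝ)) (b := 1)).isBounded.subset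
      (oband_subset_Icc hX hl0 hu1)).measure_lt_top).ne)

/-- The domain of `bandRep` is the open band. [this node] -/
@[simp] theorem bandRep_domain {N : ℕ} (X : Set (Fin N → ℝ)) (hXs : IsSemialgebraic ℚ X)
    (hX : X ⊆ Icc 0 1) (l u : (Fin N → ℝ) → ℝ) (hl : IsSemialgebraicFunOn ℚ X l)
    (hu : IsSemialgebraicFunOn ℚ X u) (hl0 : ∀ x ∈ X, 0 ≤ l x) (hu1 : ∀ x ∈ X, u x ≤ 1) (q : ℚ) :
    (bandRep X hXs hX l u hl hu hl0 hu1 q).domain = oband X l u := rfl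

/-- The integrand of `bandRep` is the constant `q`. [this node] -/
@[simp] theorem bandRep_integrand {N : ℕ} (X : Set (Fin N → ℝ)) (hXs : IsSemialgebraic ℚ X)
    (hX : X ⊆ Icc 0 1) (l u : (Fin N → ℝ) → ℝ) (hl : IsSemialgebraicFunOn ℚ X l)
    (hu : IsSemialgebraicFunOn ℚ X u) (hl0 : ∀ x ∈ X, 0 ≤ l x) (hu1 : ∀ x ∈ X, u x ≤ 1) (q : ℚ)
    (z : Fin (N + 1) → ℝ) : (bandRep X hXs hX l u hl hu hl0 hu1 q).integrand z = (q : ℝ) := rfl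

/-- The length representation `[X, q·(u − l)]` of a weighted band. [KontsevichZagier2001 §1.1] -/
def lenRep {N : ℕ} (X : Set (Fin N → ℝ)) (hXs : IsSemialgebraic ℚ X) (hX : X ⊆ Icc 0 1)
    (l u : (Fin N → ℝ) → ℝ) (hl : IsSemialgebraicFunOn ℚ X l) (hu : IsSemialgebraicFunOn ℚ X u)
    (hl0 : ∀ x ∈ X, 0 ≤ l x) (hlu : ∀ x ∈ X, l x ≤ u x) (hu1 : ∀ x ∈ X, u x ≤ 1) (q : ℚ) :
    KZ.IntegralRep N :=
  bddRep X hXs ((isCompact_Icc (a := (0 : Fin N → ℝ)) (b := 1)).isBounded.subset hX)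
    (fun x => (q : ℝ) * (u x - l x))
    (IsSemialgebraicFunOn.mul_holds (isSemialgebraicFunOn_ratCast hXs q)
      (IsSemialgebraicFunOn.sub_holds hu hl)) |(q : ℝ)| fun x hx => by
      rw [abs_mul]
      refine mul_le_of_le_one_right (abs_nonneg _) ?_
      rw [abs_le]
      constructor <;> nlinarith [hl0 x hx, hlu x hx, hu1 x hx]

/-- **Rule (3) on a weighted band**: `[{x ∈ X, l x < t < u x}, q] − [X, q·(u x − l x)]` is a
relation (Newton–Leibniz along the fibre with the primitive `q·t`, then opening the fibres).
[KontsevichZagier2001 §1.2 rule (3)] -/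
theorem of_bandRep_sub_of_lenRep_mem_relations {N : ℕ} (X : Set (Fin N → ℝ))
    (hXs : IsSemialgebraic ℚ X) (hX : X ⊆ Icc 0 1) (l u : (Fin N → ℝ) → ℝ)
    (hl : IsSemialgebraicFunOn ℚ X l) (hu : IsSemialgebraicFunOn ℚ X u) (hl0 : ∀ x ∈ X, 0 ≤ l x)
    (hlu : ∀ x ∈ X, l x ≤ u x) (hu1 : ∀ x ∈ X, u x ≤ 1) (q : ℚ) :
    KZ.of (bandRep X hXs hX l u hl hu hl0 hu1 q) - KZ.of (lenRep X hXs hX l u hl hu hl0 hlu hu1 q) ∈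
      KZ.relations := by
  have hband : IsSemialgebraic ℚ (KZlog.band X l u) := KZlog.isSemialgebraic_band hl hu
  have hbandI : KZlog.band X l u ⊆ Icc 0 1 := by
    intro z hz
    rw [KZlog.mem_band] at hz
    obtain ⟨hzX, h1, h2⟩ := hz
    have hI := hX hzX
    refine ⟨fun j => ?_, fun j => ?_⟩
    · refine Fin.lastCases ?_ (fun i => ?_) j
      · exact (hl0 _ hzX).trans h1
      · simpa [Fin.init] using hI.1 i
    · refine Fin.lastCases ?_ (fun i => ?_) j
      · exact h2.trans (hu1 _ hzX)
      · simpa [Fin.init] using hI.2 i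
  have hXb : Bornology.IsBounded X := (isCompact_Icc (a := (0 : Fin N → ℝ)) (b := 1)).isBounded.subset hX
  obtain ⟨rb, rd, hrbd, hrbi, hrdd, hrdi, hrel⟩ := KZ.exists_band_newtonLeibniz hXs l u hl hu hlu
    (fun z => (q : ℝ) * z (Fin.last N)) (fun _ => (q : ℝ))
    (IsSemialgebraicFunOn.mul_holds (isSemialgebraicFunOn_ratCast hband q)
      (isSemialgebraicFunOn_apply hband (Fin.last N)))
    (isSemialgebraicFunOn_ratCast hband q)
    (fun x _ => by
      simp only [Fin.snoc_last]
      exact (continuous_const.mul continuous_id).continuousOn)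
    (fun x _ t _ => by
      simp only [Fin.snoc_last]
      simpa using (hasDerivAt_id t).const_mul (q : ℝ))
    (integrableOn_const (hs :=
      (((isCompact_Icc (a := (0 : Fin (N + 1) → ℝ)) (b := 1)).isBounded.subset hbandI).measure_lt_top).ne))
    ((IsSemialgebraicFunOn.mul_holds (isSemialgebraicFunOn_ratCast hXs q)
      (IsSemialgebraicFunOn.sub_holds hu hl)).congr fun x _ => by simp [mul_sub])
    ((lenRep X hXs hX l u hl hu hl0 hlu hu1 q).integrableOn.congr_fun (fun x _ => by
      simp [lenRep, bddRep, mul_sub]) hXs.measurableSet_holds)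
  obtain ⟨r', hr'd, hr'i, hrel'⟩ := KZ.of_sub_of_restrict_openBand_mem_relations hl hu rb hrbd
  have h1 : KZ.of (bandRep X hXs hX l u hl hu hl0 hu1 q) - KZ.of r' ∈ KZ.relations :=
    KZ.of_sub_of_mem_relations_of_eqOn (by rw [hr'd]; rfl) fun z _ => by rw [hr'i, hrbi]; rfl
  have h2 : KZ.of rd - KZ.of (lenRep X hXs hX l u hl hu hl0 hlu hu1 q) ∈ KZ.relations :=
    KZ.of_sub_of_mem_relations_of_eqOn (by rw [hrdd]; rfl) fun x _ => by
      rw [hrdi]; simp [lenRep, bddRep, mul_sub]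
  have : KZ.of (bandRep X hXs hX l u hl hu hl0 hu1 q) - KZ.of (lenRep X hXs hX l u hl hu hl0 hlu hu1 q) =
      (KZ.of (bandRep X hXs hX l u hl hu hl0 hu1 q) - KZ.of r') - (KZ.of rb - KZ.of r') +
        (KZ.of rb - KZ.of rd) + (KZ.of rd - KZ.of (lenRep X hXs hX l u hl hu hl0 hlu hu1 q)) := by abel
  rw [this]
  exact add_mem (add_mem (sub_mem h1 hrel') hrel) h2

end Summit.KontsevichZagierPeriods.RootDecompWalshStrata.ConicDescent

end
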